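import Summits.RiemannHypothesis.Statement
import Literature.NumberTheory.LFunctions.HorocycleRH
import Literature.NumberTheory.LFunctions.HorocycleEquidistribution
import Literature.NumberTheory.LFunctions.GeneralizedRH
import Mathlib.Analysis.SpecialFunctions.Pow.Real
import Mathlib.Analysis.Asymptotics.Defs
import Mathlib.NumberTheory.Modular

/-!
# RiemannHypothesis / Horocycle — assembly bookkeeping

Route `RiemannHypothesis/Horocycle` (RH as an equidistribution RATE `O(y^(θ-ε))` for closed
horocycles on the modular surface; Zagier 1981, Sarnak 1981). Write `Rate θ` for the Prop
"every smooth `SL(2,ℤ)`-invariant cusp-supported `F` has `∫₀¹ F(x+iy) dx - c = O(y^(θ-ε))` for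
all `ε > 0` as `y → 0⁺`" (spelled out in full below; no definition is introduced).

This file records the elementary implications between the route's items:
* `Rate` is antitone in `θ` (`horocycleRate_anti`): on `(0,1)`, `y^(θ-ε) ≤ y^(θ'-ε)` for `θ' ≤ θ`;
* the dictionary item `stmt-RiemannHypothesis-0462` (`Rate θ ↔ QuasiRH (2-2θ)` on `[1/2, 3/4]`)
  at `θ = 3/4`, with the fact `quasiRiemannHypothesis_one_half_iff`, gives the assembly item
  `stmt-RiemannHypothesis-0459` (`Rate (3/4) → RH`) — `riemannHypothesis_of_horocycleDictionary`;
* at `θ = 1/2` the dictionary yields `Rate (1/2)` unconditionally (its right side `QuasiRH 1` is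
  vacuous) — consistency with the unconditional item `stmt-RiemannHypothesis-0461`;
* the crux `stmt-RiemannHypothesis-0460` (`∃ θ > 1/2, Rate θ`) gives, through the dictionary, a
  zero-free strip `∃ δ > 0, QuasiRH (1-δ)`, i.e. exactly route `Strip`'s crux
  `stmt-RiemannHypothesis-0349` — `zeroFreeStrip_of_horocycleRateGain` (cross-link requested by
  the grounder).
-/

namespace Literature.RH

open Asymptotics Filter

/-- `Rate` is antitone in the exponent: a rate `O(y^(θ-ε)) ∀ε` implies `O(y^(θ'-ε)) ∀ε` for
`θ' ≤ θ`, because `y^(θ-ε) ≤ y^(θ'-ε)` for `0 < y ≤ 1`. [folklore] -/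
theorem horocycleRate_anti {θ θ' : ℝ} (hle : θ' ≤ θ) (h : (∀ F : ℂ → ℂ, ContDiffOn ℝ (⊤ : ℕ∞) F {z : ℂ | 0 < z.im} → (∀ (g : Matrix.SpecialLinearGroup (Fin 2) ℤ) (z : UpperHalfPlane), F ↑(g • z) = F ↑z) → (∃ Y : ℝ, ∀ z : UpperHalfPlane, z ∈ ModularGroup.fd → Y < z.im → F ↑z = 0) → ∃ c : ℂ, ∀ ε : ℝ, 0 < ε → Asymptotics.IsBigO (nhdsWithin (0 : ℝ) (Set.Ioi 0)) (fun y : ℝ => (∫ x in (0 : ℝ)..1, F (↑x + ↑y * Complex.I)) - c) (fun y : ℝ => y ^ (θ - ε)))) : (∀ F : ℂ → ℂ, ContDiffOn ℝ (⊤ : ℕ∞) F {z : ℂ | 0 < z.im} → (∀ (g : Matrix.SpecialLinearGroup (Fin 2) ℤ) (z : UpperHalfPlane), F ↑(g • z) = F ↑z) → (∃ Y : ℝ, ∀ z : UpperHalfPlane, z ∈ ModularGroup.fd → Y < z.im → F ↑z = 0) → ∃ c : ℂ, ∀ ε : ℝ, 0 < ε → Asymptotics.IsBigO (nhdsWithin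 (0 : ℝ) (Set.Ioi 0)) (fun y : ℝ => (∫ x in (0 : ℝ)..1, F (↑x + ↑y * Complex.I)) - c) (fun y : ℝ => y ^ (θ' - ε))) := by
  intro F hF hinv hsupp
  obtain ⟨c, hc⟩ := h F hF hinv hsupp
  refine ⟨c, fun ε hε => (hc ε hε).trans ?_⟩
  refine IsBigO.of_bound 1 ?_
  have hmem : Set.Ioo (0 : ℝ) 1 ∈ nhdsWithin (0 : ℝ) (Set.Ioi 0) :=
    Ioo_mem_nhdsGT (by norm_num)
  filter_upwards [hmem] with y hy
  rw [one_mul, Real.norm_of_nonneg (Real.rpow_nonneg hy.1.le _),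
    Real.norm_of_nonneg (Real.rpow_nonneg hy.1.le _)]
  exact Real.rpow_le_rpow_of_exponent_ge hy.1 hy.2.le (by linarith)

/-- Assembly `stmt-RiemannHypothesis-0459` from the dictionary `stmt-RiemannHypothesis-0462`
(taken as a hypothesis) at `θ = 3/4` and the fact `quasiRiemannHypothesis_one_half_iff`
(`QuasiRH (1/2) ↔ RH`): `Rate (3/4) → RiemannHypothesis`. [Zagier 1981, Theorem p. 277] [folklore] -/
theorem riemannHypothesis_of_horocycleDictionary
    (h462 : (∀ θ : ℝ, 1 / 2 ≤ θ → θ ≤ 3 / 4 → ((∀ F : ℂ → ℂ, ContDiffOn ℝ (⊤ : ℕ∞) F {z : ℂ | 0 < z.im} → (∀ (g : Matrix.SpecialLinearGroup (Fin 2) ℤ) (z : UpperHalfPlane), F ↑(g • z) = F ↑z) → (∃ Y : ℝ, ∀ z : UpperHalfPlane, z ∈ ModularGroup.fd → Y < z.im → F ↑z = 0) → ∃ c : ℂ, ∀ ε : ℝ, 0 < ε → Asymptotics.IsBigO (nhdsWithin (0 : ℝ) (Set.Ioi 0)) (fun y : ℝ => (∫ x in (0 : ℝ)..1, F (↑x +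 ↑y * Complex.I)) - c) (fun y : ℝ => y ^ (θ - ε))) ↔ Literature.NumberTheory.LFunctions.QuasiRiemannHypothesis (2 - 2 * θ))))
    (hq : Literature.NumberTheory.LFunctions.quasiRiemannHypothesis_one_half_iff) :
    (∀ F : ℂ → ℂ, ContDiffOn ℝ (⊤ : ℕ∞) F {z : ℂ | 0 < z.im} → (∀ (g : Matrix.SpecialLinearGroup (Fin 2) ℤ) (z : UpperHalfPlane), F ↑(g • z) = F ↑z) → (∃ Y : ℝ, ∀ z : UpperHalfPlane, z ∈ ModularGroup.fd → Y < z.im → F ↑z = 0) → ∃ c : ℂ, ∀ ε : ℝ, 0 < ε → Asymptotics.IsBigO (nhdsWithin (0 : ℝ) (Set.Ioi 0)) (fun y : ℝ => (∫ x in (0 : ℝ)..1, F (↑x + ↑y * Complex.I)) - c) (fun y : ℝ => y ^ (3 / 4 - ε))) → Summit.RiemannHypothesis := by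
  intro hX
  have h := (h462 (3 / 4) (by norm_num) le_rfl).1 hX
  have e : (2 : ℝ) - 2 * (3 / 4) = 1 / 2 := by norm_num
  rw [e] at h
  exact hq.1 h

/-- Consistency check at the lower endpoint: the dictionary `stmt-RiemannHypothesis-0462` at
`θ = 1/2` yields `Rate (1/2)` unconditionally, since `QuasiRiemannHypothesis 1` is vacuous
(`1 < re s < 1` is empty). [folklore] -/
theorem horocycleRate_half_of_dictionary
    (h462 : (∀ θ : ℝ, 1 / 2 ≤ θ → θ ≤ 3 / 4 → ((∀ F : ℂ → ℂ, ContDiffOn ℝ (⊤ : ℕ∞) F {z : ℂ | 0 < z.im} → (∀ (g : Matrix.SpecialLinearGroup (Fin 2) ℤ) (z : UpperHalfPlane), F ↑(g • z) = F ↑z) → (∃ Y : ℝ, ∀ z : UpperHalfPlane, z ∈ ModularGroup.fd → Y < z.im → F ↑z = 0) → ∃ c : ℂ, ∀ ε : ℝ, 0 < ε → Asymptotics.IsBigO (nhdsWithin (0 : ℝ) (Set.Ioi 0)) (fun y : ℝ => (∫ x in (0 : ℝ)..1, F (↑x + ↑y * Complex.I)) - c) (fun y : ℝ => y ^ (θ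 - ε))) ↔ Literature.NumberTheory.LFunctions.QuasiRiemannHypothesis (2 - 2 * θ)))) :
    (∀ F : ℂ → ℂ, ContDiffOn ℝ (⊤ : ℕ∞) F {z : ℂ | 0 < z.im} → (∀ (g : Matrix.SpecialLinearGroup (Fin 2) ℤ) (z : UpperHalfPlane), F ↑(g • z) = F ↑z) → (∃ Y : ℝ, ∀ z : UpperHalfPlane, z ∈ ModularGroup.fd → Y < z.im → F ↑z = 0) → ∃ c : ℂ, ∀ ε : ℝ, 0 < ε → Asymptotics.IsBigO (nhdsWithin (0 : ℝ) (Set.Ioi 0)) (fun y : ℝ => (∫ x in (0 : ℝ)..1, F (↑x + ↑y * Complex.I)) - c) (fun y : ℝ => y ^ (1 / 2 - ε))) := by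
  refine (h462 (1 / 2) le_rfl (by norm_num)).2 ?_
  intro s _ h1 h2
  norm_num at h1
  linarith

/-- The unconditional item `stmt-RiemannHypothesis-0461` (rate `O(y^(1/2))`, no `ε`; the named
fact `zagier_horocycle_rate_half`) implies `Rate (1/2)` (rate `O(y^(1/2-ε)) ∀ε`). [folklore] -/
theorem horocycleRate_half_of_rate_half (h : Literature.NumberTheory.LFunctions.zagier_horocycle_rate_half) :
    (∀ F : ℂ → ℂ, ContDiffOn ℝ (⊤ : ℕ∞) F {z : ℂ | 0 < z.im} → (∀ (g : Matrix.SpecialLinearGroup (Fin 2) ℤ) (z : UpperHalfPlane), F ↑(g • z) = F ↑z) → (∃ Y : ℝ, ∀ z : UpperHalfPlane, z ∈ ModularGroup.fd → Y < z.im → F ↑z = 0) → ∃ c : ℂ, ∀ ε : ℝ, 0 < ε → Asymptotics.IsBigO (nhdsWithin (0 : ℝ) (Set.Ioi 0)) (fun y : ℝ => (∫ x in (0 : ℝ)..1, F (↑x + ↑y * Complex.I)) - c) (fun y : ℝ => y ^ (1 / 2 - ε))) := by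
  intro F hF hinv hsupp
  obtain ⟨c, hc⟩ := h F hF hinv hsupp
  refine ⟨c, fun ε hε => hc.trans ?_⟩
  refine IsBigO.of_bound 1 ?_
  have hmem : Set.Ioo (0 : ℝ) 1 ∈ nhdsWithin (0 : ℝ) (Set.Ioi 0) :=
    Ioo_mem_nhdsGT (by norm_num)
  filter_upwards [hmem] with y hy
  rw [one_mul, Real.norm_of_nonneg (Real.rpow_nonneg hy.1.le _),
    Real.norm_of_nonneg (Real.rpow_nonneg hy.1.le _)]
  exact Real.rpow_le_rpow_of_exponent_ge hy.1 hy.2.le (by linarith)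

/-- Cross-link of cruxes: through the dictionary `stmt-RiemannHypothesis-0462`, the Horocycle
crux `stmt-RiemannHypothesis-0460` (`∃ θ > 1/2, Rate θ`) yields a zero-free strip
`∃ δ > 0, QuasiRiemannHypothesis (1 - δ)`, which is route `Strip`'s crux
`stmt-RiemannHypothesis-0349` (clamp `θ` to `min θ (3/4)` by antitonicity, then
`δ = 2θ' - 1`). [Zagier 1981, §4] [folklore] -/
theorem zeroFreeStrip_of_horocycleRateGain
    (h462 : (∀ θ : ℝ, 1 / 2 ≤ θ → θ ≤ 3 / 4 → ((∀ F : ℂ → ℂ, ContDiffOn ℝ (⊤ : ℕ∞) F {z : ℂ | 0 < z.im} → (∀ (g : Matrix.SpecialLinearGroup (Fin 2) ℤ) (z : UpperHalfPlane), F ↑(g • z) = F ↑z) → (∃ Y : ℝ, ∀ z : UpperHalfPlane, z ∈ ModularGroup.fd → Y < z.im → F ↑z = 0) → ∃ c : ℂ, ∀ ε : ℝ, 0 < ε → Asymptotics.IsBigO (nhdsWithin (0 : ℝ) (Set.Ioi 0)) (fun y : ℝ => (∫ x in (0 : ℝ)..1, F (↑x + ↑y * Complex.I)) - c) (fun y :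 ℝ => y ^ (θ - ε))) ↔ Literature.NumberTheory.LFunctions.QuasiRiemannHypothesis (2 - 2 * θ))))
    (h460 : ∃ θ : ℝ, 1 / 2 < θ ∧ ∀ F : ℂ → ℂ, ContDiffOn ℝ (⊤ : ℕ∞) F {z : ℂ | 0 < z.im} → (∀ (g : Matrix.SpecialLinearGroup (Fin 2) ℤ) (z : UpperHalfPlane), F ↑(g • z) = F ↑z) → (∃ Y : ℝ, ∀ z : UpperHalfPlane, z ∈ ModularGroup.fd → Y < z.im → F ↑z = 0) → ∃ c : ℂ, ∀ ε : ℝ, 0 < ε → Asymptotics.IsBigO (nhdsWithin (0 : ℝ) (Set.Ioi 0)) (fun y : ℝ => (∫ x in (0 : ℝ)..1, F (↑x + ↑y * Complex.I)) - c) (fun y : ℝ => y ^ (θ - ε))) :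
    ∃ δ : ℝ, 0 < δ ∧ Literature.NumberTheory.LFunctions.QuasiRiemannHypothesis (1 - δ) := by
  obtain ⟨θ, hθ, hR⟩ := h460
  have h1 : 1 / 2 < min θ (3 / 4) := lt_min hθ (by norm_num)
  have h2 : min θ (3 / 4) ≤ 3 / 4 := min_le_right _ _
  refine ⟨2 * min θ (3 / 4) - 1, by linarith, ?_⟩
  have := (h462 _ h1.le h2).1 (horocycleRate_anti (min_le_left _ _) hR)
  have e : (1 : ℝ) - (2 * min θ (3 / 4) - 1) = 2 - 2 * min θ (3 / 4) := by ring
  rw [e]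
  exact this

end Literature.RH
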